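/-
VALUE = THEOREM, NOT summit progress (cell b2b-lgcu-borel, gen 25); crux 14079 untouched.
-/
import Mathlib
import Summits.MatrixMultiplication.MatrixMultiplication.Theorems.SubgroupIdentityDesigns.Negative.PlaneFreeClassS
import Summits.MatrixMultiplication.MatrixMultiplication.Theorems.SubgroupIdentityDesigns.Negative.DualityTransport
import Summits.MatrixMultiplication.MatrixMultiplication.Theorems.SubgroupIdentityDesigns.Negative.MemberTrichotomy
import Summits.MatrixMultiplication.MatrixMultiplication.Theorems.SubgroupIdentityDesigns.Negative.NormalSylowLaw

/-!
# Class-(S) members of a `(3,1)`-witness are irreducible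

VALUE = THEOREM (structure law for the members of HYPOTHETICAL level-one witnesses of the crux
`SubgroupIdentityDesigns`, `m = 3`, `k = 1`), NOT summit progress.  The crux item is neither
restated nor weakened; this file is a `--supports` helper under `Negative/`.

GROUP THEORY (`no_fixed_plane`, `no_fixed_line`; `p` odd, no TPP, no design).  A subgroup
`J ≤ GL₃(𝔽_p)` in the member window `|J| + 3 ≤ p³`, without quadratic unipotents and containing
two distinct subgroups of order `p`, fixes no plane `{f = 0}` (`f ∘ h ∈ 𝔽_p f` for `h ∈ J`) and no
line `⟨v⟩` (`h v ∈ 𝔽_p v`).  PROOF.  A plane is conjugated to `⟨e₀, e₁⟩` by any `x ∈ GL₃` whose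
last row is `f` (`exists_gl_row_two`, `exists_conj_le_parab`), and conjugation preserves the
window, the order-`p` subgroups and the absence of quadratic unipotents (`nq_map_conj`), so
`PlaneFreeClassS.no_plane_of_classS` applies; a line `⟨v⟩` becomes the plane `{v = 0}` for the
dual group `θ(J)`, `θ(h) = (h⁻¹)ᵀ` (`DualityTransport.dual`), and `θ` preserves the other three
hypotheses (`nq_map_dual`, via `sq_sub_one_inv`: the inverse of a quadratic unipotent is one).

MEMBER COROLLARY (`classS_member_irreducible`; TPP + level-one design + crux inequality,
`p ≥ 3`, `−2 < ε ≤ 1`).  A member `H` of a `(3,1)`-witness with a NON-NORMAL Sylow `p`-subgroup —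
class (S) of `MemberTrichotomy.member_classification`: at least two Sylow subgroups, each of
order `p`, no quadratic unipotent; member window from `LevelOneWindowAll.levelOne_member_window` —
fixes no line and no plane of `𝔽_p³`: **class-(S) members are irreducible**.  `member_four_classes`
restates the four-class theorem with this strengthening: every member is p′ (Z), Borel-confined with a normal Sylow of order `p` (N₁),
has a normal Sylow of order `p²` (N₂), or is an IRREDUCIBLE subgroup of `GL₃(𝔽_p)` with ≥ `p + 1`
Sylow subgroups of order `p` and no transvection (S) — by Mitchell's theorem (not formalised) the
latter lie in `Z · SO₃(p)` or in the finitely many primitive classes; at `p = 5, 7` the GAP census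
finds exactly `Ω₃(p)` and `SO₃(p)` (ORACLE-g25 §G25-6/7).

HONEST SCOPE.  No `(p, ε)` cell is emptied.  Sorry-free; standard axioms.
-/

set_option linter.dupNamespace false

noncomputable section

open scoped BigOperators Classical Matrix

namespace Summit.MatrixMultiplication.MatrixMultiplication.Theorems.SubgroupIdentityDesigns.Negative
namespace IrreducibleClassS

open Summit.MatrixMultiplication.MatrixMultiplication.Theorems.LieRankDesigns.Negative (GLm Mat budget)
open Literature.Barriers.MatrixMultiplication (SubgroupTPP)
open ParabolicSubgroup (parab mem_parab)
open DualityTransport (dual coe_dual dual_injective)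
open LevelOneWindowAll (levelOne_member_window)

variable {p : ℕ} [hp : Fact p.Prime]

/-! ## 1. Quadratic unipotents under inversion, duality and conjugation -/

/-- The inverse of a quadratic unipotent is a quadratic unipotent. -/
theorem sq_sub_one_inv {g : GLm p 3} (h : ((g : Mat p 3) - 1) * ((g : Mat p 3) - 1) = 0) :
    (((g⁻¹ : GLm p 3) : Mat p 3) - 1) * (((g⁻¹ : GLm p 3) : Mat p 3) - 1) = 0 := by
  have hgi : ((g⁻¹ : GLm p 3) : Mat p 3) * (g : Mat p 3) = 1 := by
    rw [← Units.val_mul, inv_mul_cancel, Units.val_one]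
  have hig : (g : Mat p 3) * ((g⁻¹ : GLm p 3) : Mat p 3) = 1 := by
    rw [← Units.val_mul, mul_inv_cancel, Units.val_one]
  have e : ((g⁻¹ : GLm p 3) : Mat p 3) - 1 =
      -(((g⁻¹ : GLm p 3) : Mat p 3) * ((g : Mat p 3) - 1)) := by
    rw [Matrix.mul_sub, hgi, Matrix.mul_one, neg_sub]
  have c : ((g : Mat p 3) - 1) * ((g⁻¹ : GLm p 3) : Mat p 3) =
      ((g⁻¹ : GLm p 3) : Mat p 3) * ((g : Mat p 3) - 1) := by
    rw [Matrix.sub_mul, hig, Matrix.one_mul, Matrix.mul_sub, hgi, Matrix.mul_one]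
  rw [e, neg_mul_neg]
  calc ((g⁻¹ : GLm p 3) : Mat p 3) * ((g : Mat p 3) - 1) *
        (((g⁻¹ : GLm p 3) : Mat p 3) * ((g : Mat p 3) - 1))
      = ((g⁻¹ : GLm p 3) : Mat p 3) *
          ((((g : Mat p 3) - 1) * ((g⁻¹ : GLm p 3) : Mat p 3)) * ((g : Mat p 3) - 1)) := by
        noncomm_ring
    _ = ((g⁻¹ : GLm p 3) : Mat p 3) * (((g⁻¹ : GLm p 3) : Mat p 3) *
          (((g : Mat p 3) - 1) * ((g : Mat p 3) - 1))) := by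
        rw [c]; noncomm_ring
    _ = 0 := by rw [h, Matrix.mul_zero, Matrix.mul_zero]

/-- "No quadratic unipotent" passes to the dual subgroup `θ(J)`, `θ(h) = (h⁻¹)ᵀ`. -/
theorem nq_map_dual {J : Subgroup (GLm p 3)}
    (hnq : ∀ h ∈ J, ((h : Mat p 3) - 1) * ((h : Mat p 3) - 1) = 0 → h = 1) :
    ∀ x ∈ J.map dual, ((x : Mat p 3) - 1) * ((x : Mat p 3) - 1) = 0 → x = 1 := by
  rintro x hx hsq
  obtain ⟨h, hh, rfl⟩ := Subgroup.mem_map.mp hx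
  have ht := congrArg Matrix.transpose hsq
  rw [Matrix.transpose_mul, Matrix.transpose_zero, coe_dual, Matrix.transpose_sub,
    Matrix.transpose_transpose, Matrix.transpose_one] at ht
  have h2 := sq_sub_one_inv ht
  rw [inv_inv] at h2
  rw [hnq h hh h2, map_one]

/-- "No quadratic unipotent" passes to conjugate subgroups `x J x⁻¹`. -/
theorem nq_map_conj {J : Subgroup (GLm p 3)} (x : GLm p 3)
    (hnq : ∀ h ∈ J, ((h : Mat p 3) - 1) * ((h : Mat p 3) - 1) = 0 → h = 1) :
    ∀ y ∈ J.map (MulAut.conj x).toMonoidHom,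
      ((y : Mat p 3) - 1) * ((y : Mat p 3) - 1) = 0 → y = 1 := by
  rintro y hy hsq
  obtain ⟨h, hh, rfl⟩ := Subgroup.mem_map.mp hy
  simp only [MulEquiv.coe_toMonoidHom, MulAut.conj_apply] at hsq ⊢
  have hXXi : (x : Mat p 3) * ((x⁻¹ : GLm p 3) : Mat p 3) = 1 := by
    rw [← Units.val_mul, mul_inv_cancel, Units.val_one]
  have hXiX : ((x⁻¹ : GLm p 3) : Mat p 3) * (x : Mat p 3) = 1 := by
    rw [← Units.val_mul, inv_mul_cancel, Units.val_one]
  have e1 : ((x * h * x⁻¹ : GLm p 3) : Mat p 3) - 1 =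
      (x : Mat p 3) * ((h : Mat p 3) - 1) * ((x⁻¹ : GLm p 3) : Mat p 3) := by
    rw [Units.val_mul, Units.val_mul, Matrix.mul_sub, Matrix.sub_mul, Matrix.mul_one, hXXi]
  rw [e1] at hsq
  have hsq' : ((h : Mat p 3) - 1) * ((h : Mat p 3) - 1) = 0 := by
    calc ((h : Mat p 3) - 1) * ((h : Mat p 3) - 1)
        = (((x⁻¹ : GLm p 3) : Mat p 3) * (x : Mat p 3)) * ((h : Mat p 3) - 1) *
            (((x⁻¹ : GLm p 3) : Mat p 3) * (x : Mat p 3)) * ((h : Mat p 3) - 1) *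
            (((x⁻¹ : GLm p 3) : Mat p 3) * (x : Mat p 3)) := by
          rw [hXiX, Matrix.one_mul, Matrix.mul_one, Matrix.mul_one]
      _ = ((x⁻¹ : GLm p 3) : Mat p 3) *
            ((x : Mat p 3) * ((h : Mat p 3) - 1) * ((x⁻¹ : GLm p 3) : Mat p 3) *
              ((x : Mat p 3) * ((h : Mat p 3) - 1) * ((x⁻¹ : GLm p 3) : Mat p 3))) *
            (x : Mat p 3) := by
          noncomm_ring
      _ = 0 := by rw [hsq, Matrix.mul_zero, Matrix.zero_mul]
  rw [hnq h hh hsq', mul_one, mul_inv_cancel]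

/-! ## 2. Conjugating a fixed plane to `⟨e₀, e₁⟩` -/

/-- An invertible matrix with prescribed nonzero last row `f`. -/
theorem exists_gl_row_two {f : Fin 3 → ZMod p} (hf : f ≠ 0) :
    ∃ x : GLm p 3, ∀ j, (x : Mat p 3) 2 j = f j := by
  have key : ∀ M : Mat p 3, M.det ≠ 0 → (∀ j, M 2 j = f j) →
      ∃ x : GLm p 3, ∀ j, (x : Mat p 3) 2 j = f j :=
    fun M hM hrow => ⟨Matrix.GeneralLinearGroup.mkOfDetNeZero M hM, hrow⟩
  by_cases h2 : f 2 = 0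
  · by_cases h0 : f 0 = 0
    · by_cases h1 : f 1 = 0
      · exact absurd (funext fun j => by fin_cases j <;> simp [h0, h1, h2]) hf
      · exact key !![1, 0, 0; 0, 0, 1; f 0, f 1, f 2]
          (by simp [Matrix.det_fin_three]; exact h1) fun j => by fin_cases j <;> rfl
    · exact key !![0, 1, 0; 0, 0, 1; f 0, f 1, f 2]
        (by simp [Matrix.det_fin_three]; exact h0) fun j => by fin_cases j <;> rfl
  · exact key !![1, 0, 0; 0, 1, 0; f 0, f 1, f 2]
      (by simp [Matrix.det_fin_three]; exact h2) fun j => by fin_cases j <;> rfl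

/-- A subgroup fixing the plane `{f = 0}` is conjugate into the standard plane stabiliser `P³₂`
(conjugate by an `x` with last row `f`). -/
theorem exists_conj_le_parab {J : Subgroup (GLm p 3)} {f : Fin 3 → ZMod p} (hf : f ≠ 0)
    (hfix : ∀ h ∈ J, ∃ b : ZMod p, f ᵥ* (h : Mat p 3) = b • f) :
    ∃ x : GLm p 3, J.map (MulAut.conj x).toMonoidHom ≤ parab (ZMod p) 3 2 := by
  obtain ⟨x, hx⟩ := exists_gl_row_two hf
  have hrow : Pi.single (2 : Fin 3) (1 : ZMod p) ᵥ* (x : Mat p 3) = f := by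
    rw [Matrix.single_one_vecMul]; ext j; exact hx j
  have hXXi : (x : Mat p 3) * ((x⁻¹ : GLm p 3) : Mat p 3) = 1 := by
    rw [← Units.val_mul, mul_inv_cancel, Units.val_one]
  refine ⟨x, fun y hy => ?_⟩
  obtain ⟨h, hh, rfl⟩ := Subgroup.mem_map.mp hy
  obtain ⟨b, hb⟩ := hfix h hh
  have hv : Pi.single (2 : Fin 3) (1 : ZMod p) ᵥ*
      (((MulAut.conj x).toMonoidHom h : GLm p 3) : Mat p 3) = b • Pi.single (2 : Fin 3) 1 := by
    simp only [MulEquiv.coe_toMonoidHom, MulAut.conj_apply]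
    rw [Units.val_mul, Units.val_mul, ← Matrix.vecMul_vecMul, ← Matrix.vecMul_vecMul, hrow, hb,
      Matrix.smul_vecMul, ← hrow, Matrix.vecMul_vecMul, hXXi, Matrix.vecMul_one]
  rw [mem_parab]
  intro s t ht hs
  have hs2 : s = 2 := by
    ext; have := s.isLt; simp only [Fin.isValue, Fin.val_two]; omega
  subst hs2
  have ht2 : t ≠ 2 := by rintro rfl; norm_num at ht
  have e := congrFun hv t
  rw [Matrix.single_one_vecMul, Matrix.row_apply] at e
  rw [e, Pi.smul_apply, Pi.single_eq_of_ne ht2, smul_zero]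

/-! ## 3. No fixed plane, no fixed line -/

/-- **No fixed plane.**  `p` odd; `J ≤ GL₃(𝔽_p)` with `|J| + 3 ≤ p³`, no quadratic unipotent and
two distinct subgroups `T₁ ≠ T₂` of order `p` cannot fix a plane `{f = 0}`, `f ≠ 0`. -/
theorem no_fixed_plane (hp2 : p ≠ 2) (J T₁ T₂ : Subgroup (GLm p 3))
    (hJ : Nat.card J + 3 ≤ p ^ 3)
    (hnq : ∀ h ∈ J, ((h : Mat p 3) - 1) * ((h : Mat p 3) - 1) = 0 → h = 1)
    (hT₁ : Nat.card T₁ = p) (hT₂ : Nat.card T₂ = p) (hne : T₁ ≠ T₂) (h₁ : T₁ ≤ J)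
    (h₂ : T₂ ≤ J) {f : Fin 3 → ZMod p} (hf : f ≠ 0)
    (hfix : ∀ h ∈ J, ∃ b : ZMod p, f ᵥ* (h : Mat p 3) = b • f) : False := by
  obtain ⟨x, hx⟩ := exists_conj_le_parab hf hfix
  have hinj : Function.Injective (MulAut.conj x).toMonoidHom := (MulAut.conj x).injective
  exact PlaneFreeClassS.no_plane_of_classS hp2 _ _ _ hx
    (by rw [Subgroup.card_map_of_injective hinj]; exact hJ) (nq_map_conj x hnq)
    (by rw [Subgroup.card_map_of_injective hinj, hT₁])
    (by rw [Subgroup.card_map_of_injective hinj, hT₂])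
    (fun h => hne (Subgroup.map_injective hinj h)) (Subgroup.map_mono h₁) (Subgroup.map_mono h₂)

/-- **No fixed line.**  Same hypotheses; `J` cannot fix a line `⟨v⟩`, `v ≠ 0` (the dual group
`θ(J)` would fix the plane `{v = 0}`). -/
theorem no_fixed_line (hp2 : p ≠ 2) (J T₁ T₂ : Subgroup (GLm p 3))
    (hJ : Nat.card J + 3 ≤ p ^ 3)
    (hnq : ∀ h ∈ J, ((h : Mat p 3) - 1) * ((h : Mat p 3) - 1) = 0 → h = 1)
    (hT₁ : Nat.card T₁ = p) (hT₂ : Nat.card T₂ = p) (hne : T₁ ≠ T₂) (h₁ : T₁ ≤ J)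
    (h₂ : T₂ ≤ J) {v : Fin 3 → ZMod p} (hv : v ≠ 0)
    (hfix : ∀ h ∈ J, ∃ a : ZMod p, (h : Mat p 3) *ᵥ v = a • v) : False := by
  have hinj : Function.Injective (dual : GLm p 3 →* GLm p 3) := dual_injective
  refine no_fixed_plane hp2 (J.map dual) (T₁.map dual) (T₂.map dual)
    (by rw [Subgroup.card_map_of_injective hinj]; exact hJ) (nq_map_dual hnq)
    (by rw [Subgroup.card_map_of_injective hinj, hT₁])
    (by rw [Subgroup.card_map_of_injective hinj, hT₂])
    (fun h => hne (Subgroup.map_injective hinj h)) (Subgroup.map_mono h₁) (Subgroup.map_mono h₂)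
    hv ?_
  rintro y hy
  obtain ⟨h, hh, rfl⟩ := Subgroup.mem_map.mp hy
  obtain ⟨a, ha⟩ := hfix h⁻¹ (J.inv_mem hh)
  exact ⟨a, by rw [coe_dual, Matrix.vecMul_transpose, ha]⟩

/-! ## 4. The member corollary -/

/-- Two distinct subgroups of order `p` of `GL₃(𝔽_p)` inside `H`, from a non-normal Sylow
`p`-subgroup of `H` of order `p`. -/
theorem two_subgroups_of_not_normal {H : Subgroup (GLm p 3)} (P : Sylow p H)
    (hP : ¬ (P : Subgroup H).Normal) (hcard : ∀ Q : Sylow p H, Nat.card Q = p) :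
    ∃ T₁ T₂ : Subgroup (GLm p 3), Nat.card T₁ = p ∧ Nat.card T₂ = p ∧ T₁ ≠ T₂ ∧
      T₁ ≤ H ∧ T₂ ≤ H := by
  have hnt : Subgroup.normalizer ((P : Subgroup H) : Set H) ≠ ⊤ := fun h =>
    hP (Subgroup.normalizer_eq_top_iff.mp h)
  obtain ⟨g, hg⟩ : ∃ g : H, g ∉ Subgroup.normalizer ((P : Subgroup H) : Set H) := by
    by_contra hall
    push Not at hall
    exact hnt ((Subgroup.eq_top_iff' _).mpr hall)
  have hgP : g • P ≠ P := fun h => hg (Sylow.smul_eq_iff_mem_normalizer.mp h)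
  have hinj := H.subtype_injective
  refine ⟨(P : Subgroup H).map H.subtype, ((g • P : Sylow p H) : Subgroup H).map H.subtype,
    by rw [Subgroup.card_map_of_injective hinj, hcard P],
    by rw [Subgroup.card_map_of_injective hinj, hcard (g • P)],
    fun h => hgP.symm (Sylow.ext (Subgroup.map_injective hinj h)),
    Subgroup.map_subtype_le _, Subgroup.map_subtype_le _⟩

/-- **Class-(S) members are irreducible.**  Under TPP + level-one design + crux inequality
(`p ≥ 3`, `−2 < ε ≤ 1`), a member `H` with a non-normal Sylow `p`-subgroup fixes no line and no
plane of `𝔽_p³`. -/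
theorem classS_member_irreducible (hp3 : 3 ≤ p) {ε : ℝ} (hε : -2 < ε) (hε1 : ε ≤ 1)
    {H₁ H₂ H₃ : Subgroup (GLm p 3)} (htpp : SubgroupTPP H₁ H₂ H₃)
    (hdes : ∃ cf : Mat p 3 → ℂ, (∀ M, 1 < M.rank → cf M = 0) ∧
      (∑ M, cf M * ZMod.stdAddChar (Matrix.trace (M * ((1 : GLm p 3) : Mat p 3)))) = 1 ∧
      ∀ a ∈ H₁, ∀ b ∈ H₂, ∀ g ∈ H₃, a * b * g ≠ 1 →
        (∑ M, cf M * ZMod.stdAddChar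
          (Matrix.trace (M * ((a * b * g : GLm p 3) : Mat p 3)))) = 0)
    (hlt : budget p 3 1 (2 + ε) <
      ((Nat.card H₁ * Nat.card H₂ * Nat.card H₃ : ℕ) : ℝ) ^ ((2 + ε) / 3))
    (H : Subgroup (GLm p 3)) (hH : H = H₁ ∨ H = H₂ ∨ H = H₃) (P : Sylow p H)
    (hP : ¬ (P : Subgroup H).Normal) :
    (∀ v : Fin 3 → ZMod p, v ≠ 0 → ∃ h ∈ H, ∀ a : ZMod p, (h : Mat p 3) *ᵥ v ≠ a • v) ∧
      ∀ f : Fin 3 → ZMod p, f ≠ 0 → ∃ h ∈ H, ∀ b : ZMod p, f ᵥ* (h : Mat p 3) ≠ b • f := by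
  have hp2 : p ≠ 2 := by omega
  -- the member window |H| + 3 ≤ p³
  have hwin : Nat.card H + 3 ≤ p ^ 3 := by
    obtain ⟨⟨-, hx, -⟩, ⟨-, hy⟩, ⟨-, hz, -⟩⟩ :=
      levelOne_member_window (l := 2) (by norm_num) hp3 hε hε1 htpp hdes hlt
    rcases hH with rfl | rfl | rfl
    · exact hx
    · exact hy
    · exact hz
  -- class (S): all Sylow of order p, no quadratic unipotent
  have hS : (∀ Q : Sylow p H, ¬ (Q : Subgroup H).Normal ∧ Nat.card Q = p) ∧
      ∀ u ∈ H, ((u : Mat p 3) - 1) * ((u : Mat p 3) - 1) = 0 → u = 1 := by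
    rcases MemberTrichotomy.member_classification hp3 hε hε1 htpp hdes hlt H hH with
      hZ | ⟨hN, -⟩ | hN | hS
    · exfalso
      have hbot : (P : Subgroup H) = ⊥ := Subgroup.eq_bot_of_card_eq _ (hZ P)
      exact hP (by rw [hbot]; infer_instance)
    · exact absurd (hN P).1 hP
    · exact absurd (hN P).1 hP
    · exact hS
  obtain ⟨T₁, T₂, hT₁, hT₂, hne, h₁, h₂⟩ := two_subgroups_of_not_normal P hP fun Q => (hS.1 Q).2
  refine ⟨fun v hv => ?_, fun f hf => ?_⟩
  · by_contra hcon
    push Not at hcon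
    exact no_fixed_line hp2 H T₁ T₂ hwin hS.2 hT₁ hT₂ hne h₁ h₂ hv hcon
  · by_contra hcon
    push Not at hcon
    exact no_fixed_plane hp2 H T₁ T₂ hwin hS.2 hT₁ hT₂ hne h₁ h₂ hf hcon

/-- **The four classes, with (S) irreducible.**  `MemberTrichotomy.member_classification` with its
fourth class strengthened by `classS_member_irreducible`: a member of a `(3,1)`-witness is p′ (Z),
has a normal Sylow `p`-subgroup of order `p` and fixes a flag (N₁), has a normal Sylow
`p`-subgroup of order `p²` (N₂), or (S) has only non-normal Sylow `p`-subgroups, each of order `p`,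
no quadratic unipotent, and fixes NO line and NO plane of `𝔽_p³`. -/
theorem member_four_classes (hp3 : 3 ≤ p) {ε : ℝ} (hε : -2 < ε) (hε1 : ε ≤ 1)
    {H₁ H₂ H₃ : Subgroup (GLm p 3)} (htpp : SubgroupTPP H₁ H₂ H₃)
    (hdes : ∃ cf : Mat p 3 → ℂ, (∀ M, 1 < M.rank → cf M = 0) ∧
      (∑ M, cf M * ZMod.stdAddChar (Matrix.trace (M * ((1 : GLm p 3) : Mat p 3)))) = 1 ∧
      ∀ a ∈ H₁, ∀ b ∈ H₂, ∀ g ∈ H₃, a * b * g ≠ 1 →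
        (∑ M, cf M * ZMod.stdAddChar
          (Matrix.trace (M * ((a * b * g : GLm p 3) : Mat p 3)))) = 0)
    (hlt : budget p 3 1 (2 + ε) <
      ((Nat.card H₁ * Nat.card H₂ * Nat.card H₃ : ℕ) : ℝ) ^ ((2 + ε) / 3))
    (H : Subgroup (GLm p 3)) (hH : H = H₁ ∨ H = H₂ ∨ H = H₃) :
    (∀ P : Sylow p H, Nat.card P = 1) ∨
      ((∀ P : Sylow p H, (P : Subgroup H).Normal ∧ Nat.card P = p) ∧
        ∃ v ψ : Fin 3 → ZMod p, v ≠ 0 ∧ ψ ≠ 0 ∧ ψ ⬝ᵥ v = 0 ∧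
          ∀ h ∈ H, (∃ a : ZMod p, (h : Mat p 3) *ᵥ v = a • v) ∧
            (∃ b : ZMod p, ψ ᵥ* (h : Mat p 3) = b • ψ)) ∨
      (∀ P : Sylow p H, (P : Subgroup H).Normal ∧ Nat.card P = p ^ 2) ∨
      ((∀ P : Sylow p H, ¬ (P : Subgroup H).Normal ∧ Nat.card P = p) ∧
        (∀ u ∈ H, ((u : Mat p 3) - 1) * ((u : Mat p 3) - 1) = 0 → u = 1) ∧
        (∀ v : Fin 3 → ZMod p, v ≠ 0 → ∃ h ∈ H, ∀ a : ZMod p, (h : Mat p 3) *ᵥ v ≠ a • v) ∧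
        ∀ f : Fin 3 → ZMod p, f ≠ 0 → ∃ h ∈ H, ∀ b : ZMod p, f ᵥ* (h : Mat p 3) ≠ b • f) := by
  rcases MemberTrichotomy.member_classification hp3 hε hε1 htpp hdes hlt H hH with
    hZ | hN₁ | hN₂ | hS
  · exact Or.inl hZ
  · exact Or.inr (Or.inl hN₁)
  · exact Or.inr (Or.inr (Or.inl hN₂))
  · obtain ⟨P₀⟩ := (inferInstance : Nonempty (Sylow p H))
    have hirr := classS_member_irreducible hp3 hε hε1 htpp hdes hlt H hH P₀ (hS.1 P₀).1
    exact Or.inr (Or.inr (Or.inr ⟨hS.1, hS.2, hirr.1, hirr.2⟩))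

end IrreducibleClassS
end Summit.MatrixMultiplication.MatrixMultiplication.Theorems.SubgroupIdentityDesigns.Negative
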